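import Mathlib
import Literature.Computability.AlgebraicComplexity.MultinomialEntropy

/-!
# `ThinBlockAlpha.SkewLocalStrongUSP`, line `Concat`: `stub_rungCount` (counting for the `A14` rung)

Support file for crux item `stmt-MatrixMultiplication-10598`, line `Concat` (graded tilted alphabets),
registered stub `stub_rungCount`:

`C(7k, k) ≤ 2^{(3/5) k} · multinomial(k; M·q)` for `k = 60 M`, `M` large, where
`q = (12,5,5,5,6,5,5,5,2,2,2,2,2,2)` is the integer composition (per 60 blocks) of the graded tilted
alphabet `A14` (laws: `∑ q = 60`, `∑ q·|Y| = 60`, `∑ q·|X| = 180`; entropy `H(q/60) = 3.5704` bits/block,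
rate `1.42411`/column; slack `log₂(7⁷/6⁶) − H(q/60) = 0.5713 < 3/5`).
-/

set_option linter.dupNamespace false
set_option exponentiation.threshold 500

namespace Summit.MatrixMultiplication.MatrixMultiplication.Theorems.SkewLocalStrongUSP

open Finset Filter

/-! The composition of the `A14` code per 60 blocks is written out literally as
`(![12, 5, 5, 5, 6, 5, 5, 5, 2, 2, 2, 2, 2, 2] : Fin 14 → ℕ)` ("`q14`" in the docstrings). -/

/-- `∑ q14 = 60`. -/
theorem sum_q14 : ∑ x, (![12, 5, 5, 5, 6, 5, 5, 5, 2, 2, 2, 2, 2, 2] : Fin 14 → ℕ) x = 60 := by decide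

/-- `∏ q14(x)^{q14(x)} = 12¹² · 5³⁰ · 6⁶ · 2¹²`. -/
theorem prod_q14_pow :
    ∏ x, (![12, 5, 5, 5, 6, 5, 5, 5, 2, 2, 2, 2, 2, 2] : Fin 14 → ℕ) x ^
        (![12, 5, 5, 5, 6, 5, 5, 5, 2, 2, 2, 2, 2, 2] : Fin 14 → ℕ) x =
      12 ^ 12 * 5 ^ 30 * 6 ^ 6 * 2 ^ 12 := by
  simp [Fin.prod_univ_succ]

/-- **The numerical heart of the rung** (exact integer arithmetic): per 60 blocks the `A14` code beats
`C(7k,k)·2^{-(3/5)k}` by a factor `> 3`:  `7⁴²⁰ · ∏ q^q · 3 ≤ 2³⁶ · 60⁶⁰ · 6³⁶⁰`. -/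
theorem key_numeric : 7 ^ 420 * (12 ^ 12 * 5 ^ 30 * 6 ^ 6 * 2 ^ 12) * 3 ≤ 2 ^ 36 * 60 ^ 60 * 6 ^ 360 := by
  decide

/-- **Binomial versus entropy cap**: `C(7k,k) · 6^{6k} ≤ 7^{7k}` (one term of `(1+6)^{7k}`). -/
theorem choose_mul_pow_le (k : ℕ) : (7 * k).choose k * 6 ^ (6 * k) ≤ 7 ^ (7 * k) := by
  have h : (7 : ℕ) ^ (7 * k) = ∑ m ∈ range (7 * k + 1), 6 ^ (7 * k - m) * (7 * k).choose m := by
    have h0 := add_pow 1 6 (7 * k)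
    simp only [Nat.cast_id, one_pow, one_mul] at h0
    exact h0
  rw [h]
  have hk : k ∈ range (7 * k + 1) := by rw [mem_range]; omega
  calc (7 * k).choose k * 6 ^ (6 * k) = 6 ^ (7 * k - k) * (7 * k).choose k := by
        rw [mul_comm]
        congr 2
        omega
    _ ≤ ∑ m ∈ range (7 * k + 1), 6 ^ (7 * k - m) * (7 * k).choose m :=
        single_le_sum (f := fun m => 6 ^ (7 * k - m) * (7 * k).choose m)
          (fun m _ => Nat.zero_le _) hk

/-- Composition of the `A14` code at `k = 60M` blocks: `M · q14`; it sums to `60 M`. -/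
theorem sum_mul_q14 (M : ℕ) :
    ∑ x, M * (![12, 5, 5, 5, 6, 5, 5, 5, 2, 2, 2, 2, 2, 2] : Fin 14 → ℕ) x = 60 * M := by
  rw [← mul_sum, sum_q14, mul_comm]

/-- **Multinomial lower bound** (method of types, tree lemma
`one_le_card_pow_mul_typeClassMass_self`): `(60^60/∏ q^q)^M ≤ (60M+1)^14 · multinomial(60M; M·q)`. -/
theorem pow_le_mul_multinomial (M : ℕ) (hM : 1 ≤ M) :
    ((60 : ℝ) ^ 60 / (12 ^ 12 * 5 ^ 30 * 6 ^ 6 * 2 ^ 12)) ^ M ≤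
      ((60 * M : ℕ) + 1 : ℝ) ^ 14 * (Nat.multinomial univ (fun x => M * (![12, 5, 5, 5, 6, 5, 5, 5, 2, 2, 2, 2, 2, 2] : Fin 14 → ℕ) x) : ℝ) := by
  have h := Literature.Computability.AlgebraicComplexity.one_le_card_pow_mul_typeClassMass_self
    (fun x => M * (![12, 5, 5, 5, 6, 5, 5, 5, 2, 2, 2, 2, 2, 2] : Fin 14 → ℕ) x) (sum_mul_q14 M)
  rw [Fintype.card_fin] at h
  -- the product `∏ ((M q x)/(60M))^{M q x} = (∏ (q x/60)^{q x})^M`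
  have hM0 : (M : ℝ) ≠ 0 := by exact_mod_cast (by omega : M ≠ 0)
  have hprod : ∏ x, (((M * (![12, 5, 5, 5, 6, 5, 5, 5, 2, 2, 2, 2, 2, 2] : Fin 14 → ℕ) x : ℕ) : ℝ) / ((60 * M : ℕ) : ℝ)) ^ (M * (![12, 5, 5, 5, 6, 5, 5, 5, 2, 2, 2, 2, 2, 2] : Fin 14 → ℕ) x) =
      (∏ x, (((![12, 5, 5, 5, 6, 5, 5, 5, 2, 2, 2, 2, 2, 2] : Fin 14 → ℕ) x : ℝ) / 60) ^ (![12, 5, 5, 5, 6, 5, 5, 5, 2, 2, 2, 2, 2, 2] : Fin 14 → ℕ) x) ^ M := by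
    rw [← prod_pow]
    refine prod_congr rfl fun x _ => ?_
    rw [← pow_mul, mul_comm ((![12, 5, 5, 5, 6, 5, 5, 5, 2, 2, 2, 2, 2, 2] : Fin 14 → ℕ) x) M]
    congr 1
    push_cast
    field_simp
  rw [hprod] at h
  have hρ : ∏ x, (((![12, 5, 5, 5, 6, 5, 5, 5, 2, 2, 2, 2, 2, 2] : Fin 14 → ℕ) x : ℝ) / 60) ^ (![12, 5, 5, 5, 6, 5, 5, 5, 2, 2, 2, 2, 2, 2] : Fin 14 → ℕ) x = (12 ^ 12 * 5 ^ 30 * 6 ^ 6 * 2 ^ 12 : ℝ) / 60 ^ 60 := by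
    simp [Fin.prod_univ_succ]
    norm_num
  rw [hρ] at h
  have hpos : (0 : ℝ) < ((12 ^ 12 * 5 ^ 30 * 6 ^ 6 * 2 ^ 12 : ℝ) / 60 ^ 60) ^ M := by positivity
  rw [show ((60 : ℝ) ^ 60 / (12 ^ 12 * 5 ^ 30 * 6 ^ 6 * 2 ^ 12)) =
      (((12 ^ 12 * 5 ^ 30 * 6 ^ 6 * 2 ^ 12 : ℝ) / 60 ^ 60))⁻¹ by rw [inv_div], inv_pow]
  rw [inv_le_iff_one_le_mul₀ hpos]
  calc (1 : ℝ) ≤ _ := h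
    _ = _ := by ring

/-- **Rung count at `δ₀ = 3/5`**: for `k = 60M` with `(60M+1)^14 ≤ 3^M`,
`C(7k, k) ≤ 2^{(3/5)k} · multinomial(k; M·q14)`. -/
theorem choose_le_rpow_mul_multinomial {M : ℕ} (hM : 1 ≤ M) (hgrow : (60 * M + 1) ^ 14 ≤ 3 ^ M) :
    ((7 * (60 * M)).choose (60 * M) : ℝ) ≤
      (2 : ℝ) ^ ((3 / 5 : ℝ) * ((60 * M : ℕ) : ℝ)) * (Nat.multinomial univ (fun x => M * (![12, 5, 5, 5, 6, 5, 5, 5, 2, 2, 2, 2, 2, 2] : Fin 14 → ℕ) x) : ℝ) := by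
  -- abbreviations
  set P : ℝ := 12 ^ 12 * 5 ^ 30 * 6 ^ 6 * 2 ^ 12 with hP
  have hPpos : 0 < P := by rw [hP]; positivity
  set Mu : ℝ := (Nat.multinomial univ (fun x => M * (![12, 5, 5, 5, 6, 5, 5, 5, 2, 2, 2, 2, 2, 2] : Fin 14 → ℕ) x) : ℝ) with hMu
  -- (A) the binomial bound, cast to ℝ
  have hA : ((7 * (60 * M)).choose (60 * M) : ℝ) * 6 ^ (6 * (60 * M)) ≤ 7 ^ (7 * (60 * M)) := by
    exact_mod_cast choose_mul_pow_le (60 * M)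
  -- (B) the multinomial bound
  have hB : ((60 : ℝ) ^ 60 / P) ^ M ≤ ((60 * M : ℕ) + 1 : ℝ) ^ 14 * Mu := pow_le_mul_multinomial M hM
  -- (C) the numeric heart, raised to the power M
  have hC0 : (7 : ℝ) ^ 420 * P * 3 ≤ (2 : ℝ) ^ 36 * 60 ^ 60 * 6 ^ 360 := by
    rw [hP]; exact_mod_cast key_numeric
  have hC : ((7 : ℝ) ^ 420 * P * 3) ^ M ≤ ((2 : ℝ) ^ 36 * 60 ^ 60 * 6 ^ 360) ^ M :=
    pow_le_pow_left₀ (by positivity) hC0 M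
  -- growth hypothesis, cast
  have hG : ((60 * M : ℕ) + 1 : ℝ) ^ 14 ≤ (3 : ℝ) ^ M := by
    have h' : (((60 * M + 1) ^ 14 : ℕ) : ℝ) ≤ ((3 ^ M : ℕ) : ℝ) := by exact_mod_cast hgrow
    push_cast at h' ⊢
    exact h'
  -- the exponent `(3/5)·(60M) = 36M`
  have hexp : (2 : ℝ) ^ ((3 / 5 : ℝ) * ((60 * M : ℕ) : ℝ)) = (2 : ℝ) ^ (36 * M) := by
    rw [show ((3 / 5 : ℝ) * ((60 * M : ℕ) : ℝ)) = ((36 * M : ℕ) : ℝ) by push_cast; ring]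
    rw [Real.rpow_natCast]
  rw [hexp]
  -- normalise the exponents to `M`-th powers of constants, then make the constants opaque
  have e7 : (7 : ℝ) ^ (7 * (60 * M)) = (7 ^ 420) ^ M := by rw [← pow_mul]; congr 1; ring
  have e6 : (6 : ℝ) ^ (6 * (60 * M)) = (6 ^ 360) ^ M := by rw [← pow_mul]; congr 1; ring
  have e2 : (2 : ℝ) ^ (36 * M) = (2 ^ 36) ^ M := by rw [← pow_mul]
  rw [e7, e6] at hA
  rw [e2]
  have hApos : (0 : ℝ) < 7 ^ 420 := by positivity
  have hSpos : (0 : ℝ) < 6 ^ 360 := by positivity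
  have hTpos : (0 : ℝ) < 2 ^ 36 := by positivity
  have hUpos : (0 : ℝ) < 60 ^ 60 := by positivity
  have hGpos : (0 : ℝ) < ((60 * M : ℕ) + 1 : ℝ) ^ 14 := by positivity
  have hMupos : (0 : ℝ) ≤ Mu := by rw [hMu]; positivity
  have hchoose : (0 : ℝ) ≤ ((7 * (60 * M)).choose (60 * M) : ℝ) := by positivity
  clear_value P Mu
  generalize (7 : ℝ) ^ 420 = A at hA hC hApos
  generalize (6 : ℝ) ^ 360 = S at hA hC hSpos
  generalize (2 : ℝ) ^ 36 = T at hC hTpos ⊢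
  generalize (60 : ℝ) ^ 60 = U at hB hC hUpos
  generalize ((60 * M : ℕ) + 1 : ℝ) ^ 14 = G at hB hG hGpos
  generalize ((7 * (60 * M)).choose (60 * M) : ℝ) = C at hA hchoose ⊢
  -- pure algebra from here
  have key1 : C * S ^ M * P ^ M * 3 ^ M ≤ T ^ M * U ^ M * S ^ M :=
    calc C * S ^ M * P ^ M * 3 ^ M ≤ A ^ M * P ^ M * 3 ^ M := by gcongr
      _ = (A * P * 3) ^ M := by rw [mul_pow, mul_pow]
      _ ≤ (T * U * S) ^ M := hC
      _ = T ^ M * U ^ M * S ^ M := by rw [mul_pow, mul_pow]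
  have key2 : C * P ^ M * 3 ^ M ≤ T ^ M * U ^ M := by
    have hSM : (0 : ℝ) < S ^ M := by positivity
    have : C * P ^ M * 3 ^ M * S ^ M ≤ T ^ M * U ^ M * S ^ M := by
      calc C * P ^ M * 3 ^ M * S ^ M = C * S ^ M * P ^ M * 3 ^ M := by ring
        _ ≤ _ := key1
    exact le_of_mul_le_mul_right this hSM
  have key3 : U ^ M ≤ 3 ^ M * Mu * P ^ M := by
    have hPM : (0 : ℝ) < P ^ M := by positivity
    rw [div_pow, div_le_iff₀ hPM] at hB
    calc U ^ M ≤ G * Mu * P ^ M := hB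
      _ ≤ 3 ^ M * Mu * P ^ M := by gcongr
  have key4 : C * P ^ M * 3 ^ M ≤ T ^ M * Mu * (P ^ M * 3 ^ M) :=
    calc C * P ^ M * 3 ^ M ≤ T ^ M * U ^ M := key2
      _ ≤ T ^ M * (3 ^ M * Mu * P ^ M) := by gcongr
      _ = T ^ M * Mu * (P ^ M * 3 ^ M) := by ring
  have hPM3 : (0 : ℝ) < P ^ M * 3 ^ M := by positivity
  rw [show C * P ^ M * 3 ^ M = C * (P ^ M * 3 ^ M) by ring] at key4
  exact le_of_mul_le_mul_right key4 hPM3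

/-- **Large `M` exist**: beyond any bound there is `M ≥ 1` with `(60M+1)^14 ≤ 3^M`. -/
theorem exists_large_M (M₀ : ℕ) : ∃ M : ℕ, M₀ ≤ M ∧ 1 ≤ M ∧ (60 * M + 1) ^ 14 ≤ 3 ^ M := by
  have hlim := tendsto_pow_const_div_const_pow_of_one_lt 14 (by norm_num : (1 : ℝ) < 3)
  have hev : ∀ᶠ n : ℕ in atTop, (n : ℝ) ^ 14 / 3 ^ n < 1 / 61 ^ 14 :=
    hlim.eventually (gt_mem_nhds (by positivity))
  obtain ⟨M, hM⟩ := (hev.and (eventually_ge_atTop (max M₀ 1))).exists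
  obtain ⟨hlt, hge⟩ := hM
  refine ⟨M, le_trans (le_max_left _ _) hge, le_trans (le_max_right _ _) hge, ?_⟩
  have hM1 : (1 : ℝ) ≤ M := by exact_mod_cast le_trans (le_max_right _ _) hge
  have h3pos : (0 : ℝ) < 3 ^ M := by positivity
  rw [div_lt_iff₀ h3pos] at hlt
  have hreal : ((60 * M + 1 : ℕ) : ℝ) ^ 14 ≤ (3 : ℝ) ^ M := by
    have h61 : ((60 * M + 1 : ℕ) : ℝ) ≤ 61 * M := by push_cast; linarith
    calc ((60 * M + 1 : ℕ) : ℝ) ^ 14 ≤ (61 * M) ^ 14 := pow_le_pow_left₀ (by positivity) h61 14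
      _ = 61 ^ 14 * (M : ℝ) ^ 14 := by rw [mul_pow]
      _ ≤ 61 ^ 14 * (1 / 61 ^ 14 * 3 ^ M) := mul_le_mul_of_nonneg_left hlt.le (by positivity)
      _ = 3 ^ M := by field_simp
  exact_mod_cast hreal

/-- **stub_rungCount** (registered signature, composition vector inlined): for `M ≥ 1` with
`(60M+1)^14 ≤ 3^M`, `C(420M, 60M) ≤ 2^{(3/5)·60M} · multinomial(60M; M·q14)`. -/
theorem stub_rungCount :
    ∀ M : ℕ, 1 ≤ M → (60 * M + 1) ^ 14 ≤ 3 ^ M →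
      ((7 * (60 * M)).choose (60 * M) : ℝ) ≤
        (2 : ℝ) ^ ((3 / 5 : ℝ) * ((60 * M : ℕ) : ℝ)) *
          (Nat.multinomial univ (fun x : Fin 14 =>
            M * (![12, 5, 5, 5, 6, 5, 5, 5, 2, 2, 2, 2, 2, 2] : Fin 14 → ℕ) x) : ℝ) :=
  fun _ hM hgrow => choose_le_rpow_mul_multinomial hM hgrow


end Summit.MatrixMultiplication.MatrixMultiplication.Theorems.SkewLocalStrongUSP
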